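import Literature.AnabelianGeometry.AbsoluteAnabelian.AbsTopI.SemiAbsoluteChains
import Literature.AnabelianGeometry.AbsoluteAnabelian.AbsTopI.RelativeGC
import HarnessLib

/-!
# [AbsTopI] Theorem 4.7 (i)/(iii) with their printed class-level hypotheses

The `𝒟`-hypothesised forms of the model-relative statements `SchemeChains.Thm_4_7_i` /
`SchemeChains.Thm_4_7_iii` of `AbsTopI/SemiAbsoluteChains.lean`: "Let `𝒟` be a chain-full set of
collections of partial construction data such that the rel-isom-DGC holds [...]" ([AbsTopI] Thm 4.7
p. 56), resp. "Suppose further that the rel-hom-DGC holds" ((iii) p. 57), with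
`AbsTopI.ConstructionDataClass.IsChainFull` / `RelIsomDGC` / `RelHomDGC` (`AbsTopI/RelativeGC.lean`).
The GSAFG-type / envelope / (a) / (b) clauses are properties of the intended instance and are
recorded, not typed.  Named facts, shape (M). [cite: MochizukiAbsTopI2012, Thm 4.7 (i) p.57]

REPAIR (appended; audit R3-N1 of abc-iut-L6-t22, 2026-08-25T21:34:27Z, witness
`HOME/staging/L4/abc-iut-L6-t22/AuditSemiAbsoluteChainsHypWitness.lean`): in `Thm_4_7_i_of 𝒟 S` /
`Thm_4_7_iii_of 𝒟 S` the class `𝒟` is a FREE parameter not linked to the extension `E` of `S`, so the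
printed class-level hypotheses are IDLE (instantiate `𝒟 :=` the empty class: `Thm_4_7_i_of ∅ S ↔
S.Thm_4_7_i`).  The LINKED forms `Thm_4_7_i_ofMem` / `Thm_4_7_iii_ofMem` below state the theorem for
scheme-chain data of the extension `(𝒟.datum b).ext X` of a MEMBER `X` of `𝒟` — print's "for `i = 1, 2`,
let `1 → Δᵢ → Πᵢ → Gᵢ → 1` be an extension of GSAFG-type that admits base-prime partial construction
data `(kᵢ, k̃ᵢ, Xᵢ, Σᵢ)` such that `([Xᵢ], [kᵢ], Σᵢ) ∈ 𝒟`" (Thm 4.7 p. 56) — exactly as abc-iut-L4-t6's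
`BelyiModel.Cor_3_7` binds [AbsTopII] Cor 3.7 to members of `𝒟`.  The unlinked decls are kept (they
are referenced by the cell's FACT-LIST rows F-0204/F-0205) and marked SUPERSEDED.
-/

noncomputable section

open CategoryTheory Topology

universe u

namespace Literature.AnabelianGeometry.AbsoluteAnabelian.AbsTopI

open Literature.AlgebraicGeometry.Frobenioids (IsSlimGroup)
open FundamentalExtension

/-- [AbsTopI] Theorem 4.7 (i) with its PRINTED hypotheses, relative to a class `𝒟` of construction
data (`AbsTopI.ConstructionDataClass`) and scheme-chain data `S` for a member: "Let `𝒟` be a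
chain-full set of collections of partial construction data such that the rel-isom-DGC holds [...]
Then (i) ...".  The GSAFG-type / envelope / (a) / (b) clauses are properties of the intended instance
and are recorded, not typed (cf. the B10 files of abc-iut-L4-t6 for the (M)-shape vocabulary).
Named fact, shape (M).  SUPERSEDED by `Thm_4_7_i_ofMem` (audit R3-N1: here `𝒟` is not linked
to `E`, so the two class-level hypotheses are idle). [cite: MochizukiAbsTopI2012, Thm 4.7 (i) p.57] -/
def Thm_4_7_i_of (𝒟 : ConstructionDataClass.{u}) {E : FundamentalExtension.{u}} {C : CuspidalData E}
    {hP : IsSlimGroup E.arith} {hΔ : IsSlimGroup E.geom} {hne : E.geom ≠ ⊥}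
    (S : SchemeChains E C hP hΔ hne) : Prop :=
  𝒟.IsChainFull → 𝒟.RelIsomDGC → S.Thm_4_7_i

/-- [AbsTopI] Theorem 4.7 (iii) with its PRINTED hypotheses ("Suppose further that the rel-hom-DGC
holds"), relative to `𝒟` and `S`.  Named fact, shape (M).  SUPERSEDED by `Thm_4_7_iii_ofMem`
(audit R3-N1: `𝒟` not linked to `E`).  DISCLOSURE (audit K7-n1): the hypothesis list names
chain-fullness and the rel-hom-DGC but NOT the rel-isom-DGC of the Thm 4.7 preamble (p. 56) — see the
docstring of `Thm_4_7_iii_ofMem` for the hom⇒isom reading. [cite: MochizukiAbsTopI2012, Thm 4.7 (iii) p.57] -/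
def Thm_4_7_iii_of (𝒟 : ConstructionDataClass.{u}) {E : FundamentalExtension.{u}}
    {C : CuspidalData E} {hP : IsSlimGroup E.arith} {hΔ : IsSlimGroup E.geom} {hne : E.geom ≠ ⊥}
    (S : SchemeChains E C hP hΔ hne) : Prop :=
  𝒟.IsChainFull → 𝒟.RelHomDGC → S.Thm_4_7_i ∧ S.Thm_4_7_iii

/-! ### Linked forms (repair of audit R3-N1): the extension is that of a MEMBER of `𝒟` -/

/-- **[AbsTopI] Theorem 4.7 (i) with its printed hypotheses, LINKED to the class**: for a member `X`
of `𝒟` over the construction-data field `k_b` (print, Thm 4.7 p. 56: "an extension of GSAFG-type that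
admits base-prime partial construction data `(kᵢ, k̃ᵢ, Xᵢ, Σᵢ)` such that `([Xᵢ], [kᵢ], Σᵢ) ∈ 𝒟`")
and scheme-chain data `S` for ITS extension `1 → Δ_X → Π_X → G_{k_b} → 1` (`(𝒟.datum b).ext X`),
"Let `𝒟` be a chain-full set of collections of partial construction data such that the rel-isom-DGC
holds [...] Then (i)" the natural functors `Chain(X̃/X) → Chain(Π)` etc. are equivalences
(`SchemeChains.Thm_4_7_i`).  The GSAFG-type / envelope / (a) / (b) clauses remain properties of the
intended instance (recorded, not typed).  Named fact, shape (M); repairs `Thm_4_7_i_of`.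
[cite: MochizukiAbsTopI2012, Thm 4.7 (i) p.57] -/
def Thm_4_7_i_ofMem (𝒟 : ConstructionDataClass.{u}) (b : 𝒟.Base) (X : (𝒟.datum b).Obj)
    {C : CuspidalData ((𝒟.datum b).ext X)} {hP : IsSlimGroup ((𝒟.datum b).ext X).arith}
    {hΔ : IsSlimGroup ((𝒟.datum b).ext X).geom} {hne : ((𝒟.datum b).ext X).geom ≠ ⊥}
    (S : SchemeChains ((𝒟.datum b).ext X) C hP hΔ hne) : Prop :=
  𝒟.Mem b X → 𝒟.IsChainFull → 𝒟.RelIsomDGC → S.Thm_4_7_i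

/-- **[AbsTopI] Theorem 4.7 (iii) with its printed hypotheses, LINKED to the class** ("Suppose further
that the rel-hom-DGC holds, and that `Xᵢ` is a hyperbolic orbicurve", p. 57): for a member `X` of `𝒟`
over `k_b` that is a hyperbolic orbicurve of the class and scheme-chain data `S` for its extension,
chain-fullness and the rel-hom-DGC give Thm 4.7 (i) and (iii) for `S`.  Named fact, shape (M); repairs
`Thm_4_7_iii_of`.  DISCLOSURE (audit K7-n1, ref-k g6): print's (iii) is "Suppose FURTHER ..." over the
Thm 4.7 preamble (p. 56), which assumes that `𝒟` is chain-full AND that the rel-ISOM-DGC holds; the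
hypothesis list here names `IsChainFull` and `RelHomDGC` only (the same list as print's own application
in Example 4.8 (ii) p. 58, where only [pGC] Thm A is cited).  The omission rests on the reading
"rel-hom-DGC ⇒ rel-isom-DGC", which is a KERNEL THEOREM for classes whose data are functorial
(`f ↦ [π₁(f)]` respects identities/composition and `IsIso` = two-sided invertible):
`AbsTopI.ConstructionDataClass.relIsomDGC_of_relHomDGC` in `RelativeGCFunctoriality.lean` ([pGC] p. 3
remark (3) "manifestly a special case of Theorem A"); for a non-functorial abstract `𝒟` the (i)-conjunct
below is asserted under hypotheses weaker than print's. [cite: MochizukiAbsTopI2012, Thm 4.7 (iii) p.57] -/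
def Thm_4_7_iii_ofMem (𝒟 : ConstructionDataClass.{u}) (b : 𝒟.Base) (X : (𝒟.datum b).Obj)
    {C : CuspidalData ((𝒟.datum b).ext X)} {hP : IsSlimGroup ((𝒟.datum b).ext X).arith}
    {hΔ : IsSlimGroup ((𝒟.datum b).ext X).geom} {hne : ((𝒟.datum b).ext X).geom ≠ ⊥}
    (S : SchemeChains ((𝒟.datum b).ext X) C hP hΔ hne) : Prop :=
  𝒟.Mem b X → 𝒟.IsHyperbolicOrbicurve b X → 𝒟.IsChainFull → 𝒟.RelHomDGC →
    S.Thm_4_7_i ∧ S.Thm_4_7_iii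

/-- The linked form implies the unlinked one's CONCLUSION for the member's data under the member's
hypotheses (bookkeeping: consumers of `Thm_4_7_i_of` over a member can switch to `Thm_4_7_i_ofMem`).
[cite: MochizukiAbsTopI2012, Thm 4.7 (i) p.57] -/
theorem thm_4_7_i_of_ofMem {𝒟 : ConstructionDataClass.{u}} {b : 𝒟.Base} {X : (𝒟.datum b).Obj}
    {C : CuspidalData ((𝒟.datum b).ext X)} {hP : IsSlimGroup ((𝒟.datum b).ext X).arith}
    {hΔ : IsSlimGroup ((𝒟.datum b).ext X).geom} {hne : ((𝒟.datum b).ext X).geom ≠ ⊥}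
    {S : SchemeChains ((𝒟.datum b).ext X) C hP hΔ hne} (h : Thm_4_7_i_ofMem 𝒟 b X S)
    (hmem : 𝒟.Mem b X) (hfull : 𝒟.IsChainFull) (hGC : 𝒟.RelIsomDGC) : S.Thm_4_7_i :=
  h hmem hfull hGC

/-- Conversely the unlinked (idle-hypothesis) form trivially implies the linked one.
[cite: MochizukiAbsTopI2012, Thm 4.7 (i) p.57] -/
theorem thm_4_7_i_ofMem_of_of {𝒟 : ConstructionDataClass.{u}} {b : 𝒟.Base} {X : (𝒟.datum b).Obj}
    {C : CuspidalData ((𝒟.datum b).ext X)} {hP : IsSlimGroup ((𝒟.datum b).ext X).arith}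
    {hΔ : IsSlimGroup ((𝒟.datum b).ext X).geom} {hne : ((𝒟.datum b).ext X).geom ≠ ⊥}
    {S : SchemeChains ((𝒟.datum b).ext X) C hP hΔ hne} (h : Thm_4_7_i_of 𝒟 S) :
    Thm_4_7_i_ofMem 𝒟 b X S :=
  fun _ hfull hGC => h hfull hGC

end Literature.AnabelianGeometry.AbsoluteAnabelian.AbsTopI
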